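import Summits.HubbardSuperconductivity.HubbardSuperconductivity.Theorems.AnisotropyChordRealStabilityDefs
import Summits.HubbardSuperconductivity.HubbardSuperconductivity.Theorems.AnisotropyChordEnergyConvexOfLogConcave
import Summits.AtomisticToContinuum.BoseEinsteinCondensation.Theorems.BECStronglyRayleighGroundStateStability

/-!
# Route `AnisotropyChord`: THEOREM A-STAB HOLDS — `XXZGroundStateAmplitudeStable` is a tree theorem

The theory seat's THEOREM A-STAB (memo ROTOR-THEORY-6 §63; typed in `…RealStabilityDefs` as
`XXZGroundStateAmplitudeStable`, tagged «proved on paper, Lean proof pending the Borcea–Brändén facts»)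
is PROVED here, by REDUCTION TO A CLOSED CRUX OF ANOTHER SUMMIT: item stmt-AtomisticToContinuum-9672
`BECStronglyRayleigh.GroundStateStability` («Theorem S», `…Theorems.GroundStateStability_proof`): for
every finite connected graph, every `|Δ| ≤ 1`, every real field `μ` and every magnetisation sector, every
sector ground vector `ψ` of `xxzHamiltonian 1 G (−1) Δ + Σ_x μ_x S³_x` has an OCCUPATION polynomial
`Σ_S ψ(1⁰_S) Π_{x∈S} z_x` (`1⁰_S` = index `0` on `S`, `1` off `S`) with no zero in the upper
poly-half-plane — proved in the tree from the Borcea–Brändén symbol theorem (kernel form, PROVED in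
`Literature/Combinatorics/StablePolynomials/{Basic,BasicProofs,KernelForm}`), the six-vertex Euler gate,
Lie–Trotter, multivariate Hurwitz (`…/Limits`) and sector Perron–Frobenius.

* `ampPoly_eq_prod_mul_occSum` — the two conventions differ by INVERSION: for `ψ` supported on weight
  `W` and `z` with non-zero coordinates,
  `ampPoly ψ z = (Π_x z_x) · (−1)^{(n−W)+(n−W)} … ` precisely
  `ampPoly ψ z = (Π_x z_x) · (−1)^{n−W} · Σ_S ψ(1⁰_S) Π_{x∈S} (−z_x⁻¹)`; and `z ↦ −z⁻¹` preserves the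
  upper half-plane (`Literature.Combinatorics.StablePolynomials.neg_inv_im_pos`).
* `xxzGroundStateAmplitudeStable_holds : XXZGroundStateAmplitudeStable` — **A-STAB, unconditional.**
* `xxz_gibbsWithFields_preserves_occStable`, `xxz_gibbs_preserves_occStable` — the theory seat's S2
  («`e^{−τH}` preserves stability», PORT-SPEC §71) EXPORTED BY NAME from the BEC line's landed stubs
  (`stub_eulerGate`, `stub_eulerLimit`, `stub_siteFactor`, `stub_trotterClosure`): for `|Δ| ≤ 1`, any real
  fields, `τ ≥ 0`, `e^{−τH}` maps vectors with stable occupation polynomial to such vectors.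

So of the theory seat's stability layer, A-STAB and S2 are now TREE THEOREMS; T-INT / E-CONV remain
(E-CONV is reduced to `XXZSectorHeatAmplitudeLogConcave` by `…EnergyConvexAllGraphs`).
Theory seat `hubbard-h0-rotor-theory-1`; BEC line `stable-cone-variational-selection` (summit
AtomisticToContinuum).  No definition is introduced.
-/

set_option linter.dupNamespace false

noncomputable section

namespace Summit.HubbardSuperconductivity.HubbardSuperconductivity.Theorems.AnisotropyChord

open Matrix Complex Finset
open scoped ComplexOrder
open Literature.MathematicalPhysics.QuantumLattice Literature.Probability.LatticeModels
open Summit.AtomisticToContinuum.BoseEinsteinCondensation.Cruxes.GroundStateStability.StableConeVariationalSelection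
  (stub_eulerGate stub_eulerLimit stub_siteFactor stub_trotterClosure coneSel_indicator_filter_eq
    coneSel_indicator_eq_iff)

variable {V : Type} [Fintype V] [DecidableEq V]

/-- A `Fin 2`-valued configuration takes the value `0` exactly where it does not take the value `1`.
[folklore] -/
theorem filter_eq_zero_eq_compl (σ : V → Fin 2) :
    (Finset.univ.filter fun x => σ x = 0) = (Finset.univ.filter fun x => σ x = 1)ᶜ := by
  ext x
  simp only [Finset.mem_filter, Finset.mem_univ, true_and, Finset.mem_compl]
  constructor
  · intro h h1; rw [h] at h1; exact absurd h1 (by decide)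
  · intro h
    rcases Fin.exists_fin_two.mp ⟨σ x, rfl⟩ with h0 | h1
    · exact h0
    · exact absurd h1 h

/-- **Amplitude polynomial versus occupation polynomial (inversion).** For `ψ` supported on the
configurations of weight `W` (`W` sites with value `1`) and `z` with non-zero coordinates,
`a_ψ(z) = Σ_σ ψ(σ) Π_{σ x = 1} z_x = (Π_x z_x) (−1)^{n−W} Σ_S ψ(1⁰_S) Π_{x∈S} (−z_x⁻¹)`, where
`1⁰_S` is the configuration equal to `0` on `S` and `1` off `S` (the occupation convention of
`BECStronglyRayleigh.GroundStateStability`). [folklore] -/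
theorem ampPoly_eq_prod_mul_occSum {W : ℕ} (ψ : TensorIndex V 2 → ℂ)
    (hψ : ∀ σ : TensorIndex V 2, (∑ x, (σ x : ℕ)) ≠ W → ψ σ = 0) (z : V → ℂ) (hz : ∀ x, z x ≠ 0) :
    ampPoly ψ z = (∏ x, z x) * (-1) ^ (Fintype.card V - W) *
      ∑ S : Finset V, ψ (fun i => if i ∈ S then 0 else 1) * ∏ i ∈ S, (-(z i)⁻¹) := by
  -- reindex the occupation sum by configurations
  let e : Finset V ≃ (V → Fin 2) :=
    { toFun := fun S i => if i ∈ S then 0 else 1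
      invFun := fun σ => Finset.univ.filter fun x => σ x = 0
      left_inv := fun S => ((coneSel_indicator_eq_iff S _).1 rfl).symm
      right_inv := fun σ => coneSel_indicator_filter_eq σ }
  have hre : (∑ S : Finset V, ψ (fun i => if i ∈ S then 0 else 1) * ∏ i ∈ S, (-(z i)⁻¹)) =
      ∑ σ : V → Fin 2, ψ σ * ∏ i ∈ Finset.univ.filter (fun x => σ x = 0), (-(z i)⁻¹) := by
    refine Fintype.sum_equiv e _ _ fun S => ?_
    have hS : Finset.univ.filter (fun x => e S x = 0) = S := ((coneSel_indicator_eq_iff S _).1 rfl).symm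
    rw [hS]
    rfl
  rw [hre, ampPoly, Finset.mul_sum]
  refine Finset.sum_congr rfl fun σ _ => ?_
  by_cases hσ : (∑ x, (σ x : ℕ)) = W
  · -- a weight-`W` configuration: `#{σ = 1} = W`, `#{σ = 0} = n − W`
    have h1 : (Finset.univ.filter fun x => σ x = 1).card = W := by rw [← weight_eq_card_filter, hσ]
    have h0 : (Finset.univ.filter fun x => σ x = 0).card = Fintype.card V - W := by
      rw [filter_eq_zero_eq_compl, Finset.card_compl, h1]
    have hsplit : (∏ x, z x) = (∏ x ∈ Finset.univ.filter (fun x => σ x = 1), z x) *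
        ∏ x ∈ Finset.univ.filter (fun x => σ x = 0), z x := by
      rw [filter_eq_zero_eq_compl, Finset.prod_mul_prod_compl]
    have hneg : (∏ i ∈ Finset.univ.filter (fun x => σ x = 0), (-(z i)⁻¹)) =
        (-1) ^ (Fintype.card V - W) * ∏ i ∈ Finset.univ.filter (fun x => σ x = 0), (z i)⁻¹ := by
      rw [← h0, ← Finset.prod_const, ← Finset.prod_mul_distrib]
      exact Finset.prod_congr rfl fun i _ => by ring
    have hinv : (∏ x ∈ Finset.univ.filter (fun x => σ x = 0), z x) *
        ∏ i ∈ Finset.univ.filter (fun x => σ x = 0), (z i)⁻¹ = 1 := by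
      rw [← Finset.prod_mul_distrib]
      exact Finset.prod_eq_one fun i _ => mul_inv_cancel₀ (hz i)
    have hsq : ((-1 : ℂ) ^ (Fintype.card V - W)) * (-1) ^ (Fintype.card V - W) = 1 := by
      rw [← pow_add, ← two_mul, pow_mul, neg_one_sq, one_pow]
    calc ψ σ * ∏ x ∈ Finset.univ.filter (fun x => σ x = 1), z x
        = ψ σ * (∏ x ∈ Finset.univ.filter (fun x => σ x = 1), z x) *
            (((∏ x ∈ Finset.univ.filter (fun x => σ x = 0), z x) *
              ∏ i ∈ Finset.univ.filter (fun x => σ x = 0), (z i)⁻¹) *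
            (((-1 : ℂ) ^ (Fintype.card V - W)) * (-1) ^ (Fintype.card V - W))) := by
          rw [hinv, hsq, mul_one, mul_one]
      _ = (∏ x, z x) * (-1) ^ (Fintype.card V - W) *
            (ψ σ * ∏ i ∈ Finset.univ.filter (fun x => σ x = 0), (-(z i)⁻¹)) := by
          rw [hsplit, hneg]; ring
  · rw [hψ σ hσ, zero_mul, zero_mul, mul_zero]

/-- **THEOREM A-STAB holds** (memo ROTOR-THEORY-6 §63): on every finite connected graph and for every
`Δ ∈ [−1, 1]`, every sector ground state of `H(Δ) = xxzHamiltonian 1 G (−1) Δ` has a stable amplitude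
polynomial.  From `BECStronglyRayleigh.GroundStateStability` (closed crux stmt-AtomisticToContinuum-9672,
zero fields) at the inverted point `−z⁻¹ ∈ ℍ^V`, via `ampPoly_eq_prod_mul_occSum`. [folklore] -/
theorem xxzGroundStateAmplitudeStable_holds : XXZGroundStateAmplitudeStable := by
  intro V _ _ G _ hG M Δ h1 h2 ψ hψ z hz
  obtain ⟨hψK, hψ1, hHψ⟩ := hψ
  have hψ0 : ψ ≠ 0 := by
    intro h
    rw [h, dotProduct_zero] at hψ1
    exact zero_ne_one hψ1
  obtain ⟨W, -, hMW⟩ := exists_weight_of_mem_spinZSector hψK hψ0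
  have hsupp : ∀ σ : TensorIndex V 2, (∑ x, (σ x : ℕ)) ≠ W → ψ σ = 0 := by
    have hK := hψK
    rw [hMW] at hK
    exact (LiebMattis.mem_spinZSector_weight_iff 1 W ψ).1 hK
  have hzne : ∀ x, z x ≠ 0 := fun x h => (hz x).ne' (by rw [h, Complex.zero_im])
  have hGS := Summit.AtomisticToContinuum.BoseEinsteinCondensation.Theorems.GroundStateStability_proof
    V G hG Δ (fun _ => (0 : ℝ)) (abs_le.mpr ⟨h1, h2⟩) M ψ hψK hψ0
  simp only [Complex.ofReal_zero, zero_smul, Finset.sum_const_zero, add_zero] at hGS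
  have key := hGS hHψ (fun x => -(z x)⁻¹) (fun x => Literature.Combinatorics.StablePolynomials.neg_inv_im_pos (hz x))
  rw [ampPoly_eq_prod_mul_occSum ψ hsupp z hzne]
  exact mul_ne_zero (mul_ne_zero (Finset.prod_ne_zero_iff.mpr fun x _ => hzne x)
    (pow_ne_zero _ (neg_ne_zero.mpr one_ne_zero))) key

/-- **S2 of the theory seat's PORT-SPEC §71, PROVED (exported by name from the BEC line's landed stubs):**
for `|Δ| ≤ 1`, any real fields `μ` and `τ ≥ 0`, the imaginary-time evolution
`e^{−τH}`, `H = xxzHamiltonian 1 G (−1) Δ + Σ_x μ_x S³_x`, maps every vector whose occupation polynomial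
`Σ_S φ(1⁰_S) z^S` has no zero in `ℍ^V` to a vector with the same property (any finite graph).
Composition `stub_trotterClosure (stub_eulerLimit ∘ stub_eulerGate) stub_siteFactor`. [folklore] -/
theorem xxz_gibbsWithFields_preserves_occStable (G : SimpleGraph V) [DecidableRel G.Adj] {Δ : ℝ}
    (hΔ : |Δ| ≤ 1) (μ : V → ℝ) {τ : ℝ} (hτ : 0 ≤ τ) (φ : TensorIndex V 2 → ℂ)
    (hφ : ∀ z : V → ℂ, (∀ i, 0 < (z i).im) →
      (∑ S : Finset V, φ (fun i => if i ∈ S then 0 else 1) * ∏ i ∈ S, z i) ≠ 0) :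
    ∀ z : V → ℂ, (∀ i, 0 < (z i).im) →
      (∑ S : Finset V, (Matrix.gibbsWeight τ (xxzHamiltonian 1 G (-1) Δ +
          ∑ x : V, ((μ x : ℝ) : ℂ) • siteSpin 1 x 2) *ᵥ φ) (fun i => if i ∈ S then 0 else 1) *
        ∏ i ∈ S, z i) ≠ 0 :=
  stub_trotterClosure
    (fun Λ _ _ x y hxy Δ t hΔ ht φ hφ =>
      stub_eulerLimit Λ _ (fun ε hε0 hε1 φ' hφ' => stub_eulerGate Λ x y hxy Δ ε hΔ hε0 hε1 φ' hφ')
        t ht φ hφ)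
    stub_siteFactor V G Δ μ hΔ τ hτ φ hφ

/-- **S2 without fields:** for `|Δ| ≤ 1` and `τ ≥ 0`, `e^{−τH(Δ)} = NormedSpace.exp (−τ • H(Δ))` maps
vectors with stable occupation polynomial to such vectors. [folklore] -/
theorem xxz_gibbs_preserves_occStable (G : SimpleGraph V) [DecidableRel G.Adj] {Δ : ℝ}
    (hΔ : |Δ| ≤ 1) {τ : ℝ} (hτ : 0 ≤ τ) (φ : TensorIndex V 2 → ℂ)
    (hφ : ∀ z : V → ℂ, (∀ i, 0 < (z i).im) →
      (∑ S : Finset V, φ (fun i => if i ∈ S then 0 else 1) * ∏ i ∈ S, z i) ≠ 0) :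
    ∀ z : V → ℂ, (∀ i, 0 < (z i).im) →
      (∑ S : Finset V, (NormedSpace.exp (-(τ : ℂ) • xxzHamiltonian 1 G (-1) Δ) *ᵥ φ)
          (fun i => if i ∈ S then 0 else 1) * ∏ i ∈ S, z i) ≠ 0 := by
  have h := xxz_gibbsWithFields_preserves_occStable G hΔ (fun _ => (0 : ℝ)) hτ φ hφ
  simp only [Complex.ofReal_zero, zero_smul, Finset.sum_const_zero, add_zero, Matrix.gibbsWeight] at h
  exact h

end Summit.HubbardSuperconductivity.HubbardSuperconductivity.Theorems.AnisotropyChord
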